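/-
Copyright: the b2b-balaban cell (near-miss cell 7), T⁴-continuum fan-out; row NE7b ROUND-2 swarm, seat
t4-ne7b-formalise-leaf-10 (gen 2; row S6g′(d′) of `t4/b2b-balaban-t4-ne7b-p1/LEAVES-NE7b.md`, owner's ruling
R-OWNER-22-12 (2), this lineage's finding F-leaf10-2).  Released under the licence of the surrounding project.
-/
import Summits.QuantumFields.BalabanUV.T4Continuum.Support.HistorySiblingMass

/-!
# Sibling mass, LAYERED: the symmetrised cost charged against the PREVIOUS LAYER's zone mass is class-linear (row S6g′(d′))

Summits-side support leaf of the T⁴-continuum cell (rung (B)+1 on a FINITE torus only; NOT infinite volume, NOT the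
mass gap, NOT the Clay statement; NOT a proof of the spine estimate NE7b).  Row NE7b, route «COUNT», row S6g′
«MASS-BASED SIBLING COUNT» (R-OWNER-22-12 (2)); sequel of `Support/HistorySiblingMass` (step (d)) for the LAYERED
placement count of `Support/HistoryMassPlacement` (step (b)) — finding F-leaf10-2 of the cell's records: the count that
row S6g′(c) can symmetrise charges a part of breadth-first layer `ℓ` of its host-step against the zone mass `Z_{ℓ−1}`
of the PREVIOUS layer (not against one crowding `Q_t` per step), so the summation of (d) is redone per (layer, shape)
class.  [folklore] real arithmetic and finite sums, TREE-FREE (per-class data); nothing is quoted from print, nothing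
printed is asserted, no `[cite:]` tag, no `Prop` fact minted; constants explicit.

THE STATEMENTS.  §1 **`class_cost_le`**: ONE class of `k ≥ 1` interchangeable parts attached against a mass `Z ≥ 0`,
rank `r ≥ 0`, rate `c ≥ 0`: `k·log Z − log k! ≤ 2k + c·k·r + Z·e^{−c·r}` (`HistorySiblingMass.group_cost_le` at
`n = Q := max Z k`; the singleton class `k = 1` of a composite part is included).  §2 **`layer_cost_le`**: the classes
`g ∈ Gs` of ONE layer, all attached against the same `Z ≥ 0`, ranks with at most `ρ + 1` classes of rank `ρ` (bare-birth
classes keyed by (birth step, fatness), rank = age + fatness), `c > 0`: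
`Σ_g (k_g·log Z − log k_g!) ≤ 2·Σ_g k_g + c·Σ_g k_g·r_g + Z∕(1 − e^{−c})²` (`sum_exp_neg_rank_le`).  §3
**`layered_cost_le`**: over any finite family of layers `ℓ ∈ Ls` (of one host-step, of all host-steps of a step, or of
the whole genealogy at once), each charged against ITS previous layer's mass `Zp ℓ ≥ 0`:
`Σ_ℓ Σ_{g ∈ Gs ℓ} (k·log (Zp ℓ) − log k!) ≤ 2·Σ_ℓ Σ_g k + c·Σ_ℓ Σ_g k·r + (Σ_ℓ Zp ℓ)∕(1 − e^{−c})²` — CLASS-LINEAR once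
`Σ_ℓ Zp ℓ` is: every layer's zone mass is charged ONCE (by the next layer), the layers of one host-step partition its
parts, the host-steps of one step are disjoint sub-structures, so `Σ_ℓ Zp ℓ ≤ C_z·Σ_t M_t(G′) ≤ C_z·F_w∕(1 − σ_m)` under
row S6g′(a)'s cardinality law (displayed there, not here); `Σ k = #attached parts ≤ #merges`, `Σ k·r ≤ partnerAges +
F`.  §4 sanity: the PATH of thin siblings (every layer one class of size one against `Z = O(1)`) costs `O(length)`.

HONEST SCOPE.  As in (d): the rank-fibre hypothesis holds for BARE-BIRTH classes by construction; for COMPOSITE parts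
of one layer it is the displayed residual «equal-root composite partners» (HONEST SCOPE (ii) of `HistorySiblingMass`).
Rows S6g′(a) (cardinality law), (c) (symmetrisation) and the binding are not here.  NE7b NOT proved.
HONEST DEPENDENCY (cell): continuum YM on T⁴ ⇐ BetaPertH ∧ nine spine estimates (0/9 proved); BetaPertH ⇐ (D1) ∧ (D4)
∧ CAP+tail; G-an2-4 gates asym, D1 and NE2/3/4.  This file changes none of it.
-/

open Finset

namespace Summit.QuantumFields.BalabanUV.T4Continuum.HistorySiblingMass

noncomputable section

/-! ## §1 One class against a mass -/

/-- **ONE CLASS AGAINST A MASS.**  `k ≥ 1` interchangeable parts attached against an attachable set of mass `Z ≥ 0`,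
rank `r ≥ 0`, rate `c ≥ 0`: `k·log Z − log k! ≤ 2k + c·k·r + Z·e^{−c·r}`. [folklore] -/
theorem class_cost_le {k : ℕ} (hk : 1 ≤ k) {Z c r : ℝ} (hZ : 0 ≤ Z) (hc : 0 ≤ c) (hr : 0 ≤ r) :
    (k : ℝ) * Real.log Z - Real.log (Nat.factorial k : ℝ) ≤ 2 * k + c * k * r + Z * Real.exp (-(c * r)) := by
  have hk0 : (0 : ℝ) < k := by exact_mod_cast hk
  set Q := max Z (k : ℝ) with hQ
  have hkQ : (k : ℝ) ≤ Q := le_max_right _ _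
  have hQ0 : 0 < Q := hk0.trans_le hkQ
  -- `k log Z ≤ k log Q` (also when `Z = 0`, where `log 0 = 0 ≤ log Q` as `Q ≥ 1`)
  have hlog : Real.log Z ≤ Real.log Q := by
    rcases hZ.eq_or_lt with h0 | hpos
    · rw [← h0, Real.log_zero]
      exact Real.log_nonneg ((by exact_mod_cast hk : (1 : ℝ) ≤ k).trans hkQ)
    · exact Real.log_le_log hpos (le_max_left _ _)
  have h1 := group_cost_le hk c r hkQ le_rfl
  rw [div_self hQ0.ne', Real.log_one, mul_zero, zero_add] at h1
  -- `Q e^{−cr} ≤ (Z + k) e^{−cr} ≤ Z e^{−cr} + k`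
  have hexp1 : Real.exp (-(c * r)) ≤ 1 := by
    rw [Real.exp_le_one_iff]; nlinarith [mul_nonneg hc hr]
  have hQle : Q ≤ Z + k := max_le (by linarith [hk0.le]) (by linarith)
  have h2 : Q * Real.exp (-(c * r)) ≤ Z * Real.exp (-(c * r)) + k := by
    calc Q * Real.exp (-(c * r)) ≤ (Z + k) * Real.exp (-(c * r)) :=
          mul_le_mul_of_nonneg_right hQle (Real.exp_pos _).le
      _ = Z * Real.exp (-(c * r)) + k * Real.exp (-(c * r)) := by ring
      _ ≤ Z * Real.exp (-(c * r)) + k * 1 := by gcongr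
      _ = Z * Real.exp (-(c * r)) + k := by ring
  have h3 : (k : ℝ) * Real.log Z ≤ (k : ℝ) * Real.log Q := mul_le_mul_of_nonneg_left hlog hk0.le
  linarith

/-! ## §2 One layer: all its classes against the previous layer's mass -/

/-- **ONE LAYER.**  Classes `g ∈ Gs` of sizes `k g ≥ 1` and ranks `r g : ℕ`, at most `ρ + 1` classes of each rank `ρ`,
all attached against the same mass `Z ≥ 0`, rate `c > 0`:
`Σ_g (k_g·log Z − log k_g!) ≤ 2·Σ_g k_g + c·Σ_g k_g·r_g + Z∕(1 − e^{−c})²`. [folklore] -/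
theorem layer_cost_le {β : Type*} (Gs : Finset β) (k : β → ℕ) (r : β → ℕ) {Z c : ℝ} (hZ : 0 ≤ Z) (hc : 0 < c)
    (hk : ∀ g ∈ Gs, 1 ≤ k g) (hfib : ∀ ρ : ℕ, (Gs.filter fun g => r g = ρ).card ≤ ρ + 1) :
    ∑ g ∈ Gs, ((k g : ℝ) * Real.log Z - Real.log (Nat.factorial (k g) : ℝ)) ≤
      2 * ∑ g ∈ Gs, (k g : ℝ) + c * ∑ g ∈ Gs, (k g : ℝ) * r g + Z / (1 - Real.exp (-c)) ^ 2 := by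
  have h1 : ∑ g ∈ Gs, ((k g : ℝ) * Real.log Z - Real.log (Nat.factorial (k g) : ℝ)) ≤
      ∑ g ∈ Gs, (2 * (k g : ℝ) + c * k g * r g + Z * Real.exp (-(c * r g))) :=
    sum_le_sum fun g hg => class_cost_le (hk g hg) hZ hc.le (Nat.cast_nonneg _)
  have h2 : ∑ g ∈ Gs, (2 * (k g : ℝ) + c * k g * r g + Z * Real.exp (-(c * r g))) =
      2 * ∑ g ∈ Gs, (k g : ℝ) + c * ∑ g ∈ Gs, (k g : ℝ) * r g + Z * ∑ g ∈ Gs, Real.exp (-(c * r g)) := by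
    rw [mul_sum, mul_sum, mul_sum, ← sum_add_distrib, ← sum_add_distrib]
    refine sum_congr rfl fun g _ => ?_; ring
  have h3 := sum_exp_neg_rank_le Gs r hc hfib
  have h4 : Z * ∑ g ∈ Gs, Real.exp (-(c * r g)) ≤ Z / (1 - Real.exp (-c)) ^ 2 := by
    rw [div_eq_mul_one_div]; exact mul_le_mul_of_nonneg_left h3 hZ
  linarith

/-! ## §3 Over the layers: every layer's mass is charged once -/

/-- **OVER THE LAYERS (class-linear).**  A finite family of layers `ℓ ∈ Ls`, each with classes `Gs ℓ` (sizes `k ℓ g ≥ 1`,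
ranks `r ℓ g`, at most `ρ + 1` classes of rank `ρ` per layer) attached against the previous layer's mass `Zp ℓ ≥ 0`,
rate `c > 0`: `Σ_ℓ Σ_g (k·log (Zp ℓ) − log k!) ≤ 2·Σ_ℓ Σ_g k + c·Σ_ℓ Σ_g k·r + (Σ_ℓ Zp ℓ)∕(1 − e^{−c})²`. [folklore] -/
theorem layered_cost_le {α β : Type*} (Ls : Finset α) (Gs : α → Finset β) (k : α → β → ℕ) (r : α → β → ℕ)
    (Zp : α → ℝ) (hZ : ∀ ℓ ∈ Ls, 0 ≤ Zp ℓ) {c : ℝ} (hc : 0 < c) (hk : ∀ ℓ ∈ Ls, ∀ g ∈ Gs ℓ, 1 ≤ k ℓ g)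
    (hfib : ∀ ℓ ∈ Ls, ∀ ρ : ℕ, ((Gs ℓ).filter fun g => r ℓ g = ρ).card ≤ ρ + 1) :
    ∑ ℓ ∈ Ls, ∑ g ∈ Gs ℓ, ((k ℓ g : ℝ) * Real.log (Zp ℓ) - Real.log (Nat.factorial (k ℓ g) : ℝ)) ≤
      2 * ∑ ℓ ∈ Ls, ∑ g ∈ Gs ℓ, (k ℓ g : ℝ) + c * ∑ ℓ ∈ Ls, ∑ g ∈ Gs ℓ, (k ℓ g : ℝ) * r ℓ g +
        (∑ ℓ ∈ Ls, Zp ℓ) / (1 - Real.exp (-c)) ^ 2 := by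
  have h1 : ∑ ℓ ∈ Ls, ∑ g ∈ Gs ℓ, ((k ℓ g : ℝ) * Real.log (Zp ℓ) - Real.log (Nat.factorial (k ℓ g) : ℝ)) ≤
      ∑ ℓ ∈ Ls, (2 * ∑ g ∈ Gs ℓ, (k ℓ g : ℝ) + c * ∑ g ∈ Gs ℓ, (k ℓ g : ℝ) * r ℓ g +
        Zp ℓ / (1 - Real.exp (-c)) ^ 2) :=
    sum_le_sum fun ℓ hℓ => layer_cost_le (Gs ℓ) (k ℓ) (r ℓ) (hZ ℓ hℓ) hc (hk ℓ hℓ) (hfib ℓ hℓ)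
  have h2 : ∑ ℓ ∈ Ls, (2 * ∑ g ∈ Gs ℓ, (k ℓ g : ℝ) + c * ∑ g ∈ Gs ℓ, (k ℓ g : ℝ) * r ℓ g +
        Zp ℓ / (1 - Real.exp (-c)) ^ 2) =
      2 * ∑ ℓ ∈ Ls, ∑ g ∈ Gs ℓ, (k ℓ g : ℝ) + c * ∑ ℓ ∈ Ls, ∑ g ∈ Gs ℓ, (k ℓ g : ℝ) * r ℓ g +
        (∑ ℓ ∈ Ls, Zp ℓ) / (1 - Real.exp (-c)) ^ 2 := by
    rw [mul_sum, mul_sum, sum_div, ← sum_add_distrib, ← sum_add_distrib]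
  linarith

/-- **THE SAME WITH THE MASS BUDGET PLUGGED**: if the charged masses total at most `Ztot` (every layer's mass charged once;
row S6g′(a)'s `C_z·F_w∕(1−σ_m)` in the chain), the layered symmetrised cost is at most
`2·Σk + c·Σk·r + Ztot∕(1 − e^{−c})²`. [folklore] -/
theorem layered_cost_le_of_budget {α β : Type*} (Ls : Finset α) (Gs : α → Finset β) (k : α → β → ℕ)
    (r : α → β → ℕ) (Zp : α → ℝ) (hZ : ∀ ℓ ∈ Ls, 0 ≤ Zp ℓ) {Ztot : ℝ} (hZtot : ∑ ℓ ∈ Ls, Zp ℓ ≤ Ztot)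
    {c : ℝ} (hc : 0 < c) (hk : ∀ ℓ ∈ Ls, ∀ g ∈ Gs ℓ, 1 ≤ k ℓ g)
    (hfib : ∀ ℓ ∈ Ls, ∀ ρ : ℕ, ((Gs ℓ).filter fun g => r ℓ g = ρ).card ≤ ρ + 1) :
    ∑ ℓ ∈ Ls, ∑ g ∈ Gs ℓ, ((k ℓ g : ℝ) * Real.log (Zp ℓ) - Real.log (Nat.factorial (k ℓ g) : ℝ)) ≤
      2 * ∑ ℓ ∈ Ls, ∑ g ∈ Gs ℓ, (k ℓ g : ℝ) + c * ∑ ℓ ∈ Ls, ∑ g ∈ Gs ℓ, (k ℓ g : ℝ) * r ℓ g +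
        Ztot / (1 - Real.exp (-c)) ^ 2 := by
  have h := layered_cost_le Ls Gs k r Zp hZ hc hk hfib
  have hden : 0 ≤ 1 / (1 - Real.exp (-c)) ^ 2 := by positivity
  have hmono : (∑ ℓ ∈ Ls, Zp ℓ) / (1 - Real.exp (-c)) ^ 2 ≤ Ztot / (1 - Real.exp (-c)) ^ 2 := by
    rw [div_eq_mul_one_div, div_eq_mul_one_div Ztot]
    exact mul_le_mul_of_nonneg_right hZtot hden
  linarith

/-! ## §4 Sanity: the path of thin siblings -/

namespace Sanity

/-- ONE class of size one against a unit mass (a link of a PATH of thin siblings): cost `≤ 2 + c·r + e^{−c r}` —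
bounded per link, so a path of length `m` costs `O(m)`, where the prefix-chain form charged `Σ log i = log m!`
(F-leaf10-2). [folklore] -/
example (c r : ℝ) (hc : 0 ≤ c) (hr : 0 ≤ r) :
    (1 : ℝ) * Real.log 1 - Real.log (Nat.factorial 1 : ℝ) ≤ 2 * 1 + c * 1 * r + 1 * Real.exp (-(c * r)) := by
  have h := class_cost_le (k := 1) le_rfl (Z := 1) zero_le_one hc hr
  exact_mod_cast h

end Sanity

end

end Summit.QuantumFields.BalabanUV.T4Continuum.HistorySiblingMass
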